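import Mathlib.NumberTheory.Chebyshev
import Mathlib.Analysis.Asymptotics.AsymptoticEquivalent
import Mathlib.Analysis.SpecialFunctions.Pow.Real
import Mathlib.NumberTheory.Real.Irrational
import Literature.NumberTheory.LFunctions.RHWave0PNTProofs
import HarnessLib

/-!
# Irrationality from small integer linear forms; growth of `lcm(1, …, N)`

Topic `Literature/NumberTheory/Transcendental`. Two pieces of standard glue used by every
irrationality proof for zeta values of Apéry–Ball–Rivoal–Zudilin type (Apéry 1979, Ball–Rivoal
2001, Zudilin 2001/2004; see Fischler, Sém. Bourbaki exp. 910, §1 and §3.3), isolated here so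
that the named facts **periods.S18–S20** of `PeriodsWave0.lean` (`irrational_zetaValue_three`,
`ball_rivoal`, `zudilin`) can be discharged from the arithmetic and the asymptotics of their
linear forms alone. Everything in this file is PROVED; there are no definitions and no named
facts.

* `exists_irrational_of_integerLinearForms` — **the elementary irrationality criterion**: if
  `ℓₙ = aₙ₀ + ∑ᵢ aₙᵢ xᵢ` with *integer* coefficients, `ℓₙ → 0`, and `ℓₙ ≠ 0` for infinitely many
  `n`, then at least one `xᵢ` is irrational (if all `xᵢ = pᵢ/qᵢ` then `Q ℓₙ ∈ ℤ` for
  `Q = ∏ qᵢ`, and a sequence of integers tending to `0` vanishes eventually). This is the form in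
  which "at least one of ζ(5), ζ(7), ζ(9), ζ(11) is irrational" is concluded in
  [Zudilin2004, §8, proof of Prop. 5 / Thm. 3] and [Fischler2004, §3.3].
* `tendsto_log_lcmUpto_div` — `log D_N / N → 1` for `D_N = lcm(1, …, N)` (`Nat.lcmUpto`), i.e.
  the prime number theorem in the form `ψ(N) ~ N` (`Chebyshev.psi_eq_log_lcmUpto` and the tree's
  `Literature.NumberTheory.LFunctions.chebyshevPsi_isEquivalent_holds`); quoted as
  "the prime number theorem yields `lim (log D_n)/n = 1`" in [Zudilin2004, §8] /
  Zudilin, Izv. Math. 66 (2002), §3.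
* `eventually_psi_le_mul`, `eventually_lcmUpto_mul_le_exp` — the consequences actually used:
  `ψ(x) ≤ (1+ε) x` and `D_{c n} ≤ e^{(c+ε) n}` for all large `n`.

## References

* [Zudilin2004] W. Zudilin, *Arithmetic of linear forms involving odd zeta values*, J. Théor.
  Nombres Bordeaux 16 (2004), 251–291 (arXiv:math/0206176), §8.
* [Fischler2004] S. Fischler, *Irrationalité de valeurs de zêta (d'après Apéry, Rivoal, …)*,
  Sém. Bourbaki exp. 910, Astérisque 294 (2004), 27–62, §3.3.
-/

noncomputable section

open Filter Asymptotics Topology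

namespace Literature.NumberTheory.Transcendental

/-! ### The irrationality criterion -/

/-- **Elementary irrationality criterion for linear forms with integer coefficients.**
If `ℓ n = a₀ n + ∑ i, a n i * x i` with `a₀ n, a n i ∈ ℤ`, `ℓ n → 0` and `ℓ n ≠ 0` for
infinitely many `n`, then some `x i` is irrational. (If every `x i` were rational with common
denominator `Q`, then `Q ℓ n` would be a sequence of integers tending to `0`, hence eventually
`0`.) This is the concluding step of [Zudilin2004, §8 (Prop. 5, Thm. 3)]; cf. [Fischler2004, §3.3].
[folklore] -/
theorem exists_irrational_of_integerLinearForms {ι : Type*} [Fintype ι] (x : ι → ℝ)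
    (ℓ : ℕ → ℝ) (a₀ : ℕ → ℤ) (a : ℕ → ι → ℤ)
    (hℓ : ∀ n, ℓ n = a₀ n + ∑ i, (a n i : ℝ) * x i)
    (hsmall : Tendsto ℓ atTop (𝓝 0)) (hne : ∃ᶠ n in atTop, ℓ n ≠ 0) :
    ∃ i, Irrational (x i) := by
  classical
  by_contra hcon
  push Not at hcon
  -- every `x i` is rational: `x i = r i`
  have hrat : ∀ i, ∃ r : ℚ, x i = r := fun i => by
    have := hcon i
    unfold Irrational at this
    push Not at this
    obtain ⟨r, hr⟩ := this
    exact ⟨r, hr.symm⟩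
  choose r hr using hrat
  -- common denominator
  set Q : ℕ := ∏ i, (r i).den with hQ
  have hQpos : 0 < Q := by
    rw [hQ]
    exact Finset.prod_pos fun i _ => (r i).pos
  -- `Q * r i` is an integer
  have hint : ∀ i, ∃ z : ℤ, (Q : ℝ) * x i = z := by
    intro i
    obtain ⟨c, hc⟩ : (r i).den ∣ Q := by
      rw [hQ]
      exact Finset.dvd_prod_of_mem _ (Finset.mem_univ i)
    refine ⟨c * (r i).num, ?_⟩
    rw [hr i, hc]
    have hden : ((r i).den : ℝ) ≠ 0 := by exact_mod_cast (r i).pos.ne'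
    have hq : ((r i : ℚ) : ℝ) = (r i).num / (r i).den := Rat.cast_def (r i)
    rw [hq]
    push_cast
    field_simp
  choose z hz using hint
  -- so `Q ℓ n` is the integer `m n`
  set m : ℕ → ℤ := fun n => Q * a₀ n + ∑ i, a n i * z i with hm
  have hmℓ : ∀ n, (Q : ℝ) * ℓ n = m n := by
    intro n
    rw [hℓ n, hm]
    push_cast
    rw [mul_add, Finset.mul_sum]
    congr 1
    refine Finset.sum_congr rfl fun i _ => ?_
    rw [← hz i]
    ring
  -- `Q ℓ n → 0`, hence `|m n| < 1` eventually, hence `m n = 0` eventually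
  have hQℓ : Tendsto (fun n => (Q : ℝ) * ℓ n) atTop (𝓝 0) := by
    simpa using hsmall.const_mul (Q : ℝ)
  have hev : ∀ᶠ n in atTop, ℓ n = 0 := by
    have h1 : ∀ᶠ n in atTop, |(Q : ℝ) * ℓ n| < 1 := by
      have := (hQℓ.abs).eventually (gt_mem_nhds (show |(0 : ℝ)| < 1 by simp))
      exact this
    filter_upwards [h1] with n hn
    rw [hmℓ n] at hn
    have hm0 : m n = 0 := by
      have : |m n| < 1 := by exact_mod_cast hn
      exact Int.abs_lt_one_iff.1 this
    have hQne : (Q : ℝ) ≠ 0 := by exact_mod_cast hQpos.ne'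
    have := hmℓ n
    rw [hm0, Int.cast_zero, mul_eq_zero] at this
    exact this.resolve_left hQne
  exact (hne.and_eventually hev).exists.elim fun n hn => hn.1 hn.2

/-! ### `D_N = lcm(1, …, N)` and the prime number theorem -/

/-- The prime number theorem as a limit: `ψ(x) / x → 1` as `x → ∞`
(from `Literature.NumberTheory.LFunctions.chebyshevPsi_isEquivalent_holds`). [folklore] -/
theorem tendsto_psi_div : Tendsto (fun x : ℝ => Chebyshev.psi x / x) atTop (𝓝 1) := by
  have h := Literature.NumberTheory.LFunctions.chebyshevPsi_isEquivalent_holds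
  unfold Literature.NumberTheory.LFunctions.chebyshevPsi_isEquivalent at h
  have hz : ∀ᶠ x : ℝ in atTop, (fun x : ℝ => x) x ≠ 0 := by
    filter_upwards [eventually_gt_atTop 0] with x hx
    exact hx.ne'
  exact (isEquivalent_iff_tendsto_one hz).1 h

/-- **`log D_N / N → 1`** for `D_N = lcm(1, …, N)` — the prime number theorem in the form used by
Apéry, Ball–Rivoal and Zudilin ("the prime number theorem yields `lim_{n→∞} (log D_n)/n = 1`",
[Zudilin2004, §8]; Mathlib: `Chebyshev.psi_eq_log_lcmUpto`, `ψ(N) = log D_N`). [folklore] -/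
theorem tendsto_log_lcmUpto_div :
    Tendsto (fun N : ℕ => Real.log (Nat.lcmUpto N) / N) atTop (𝓝 1) := by
  have h := tendsto_psi_div.comp tendsto_natCast_atTop_atTop
  refine h.congr fun N => ?_
  simp only [Function.comp_apply]
  rw [Chebyshev.psi_eq_log_lcmUpto]

/-- For every `ε > 0`: `ψ(x) ≤ (1 + ε) x` for all large real `x`. [folklore] -/
theorem eventually_psi_le_mul {ε : ℝ} (hε : 0 < ε) :
    ∀ᶠ x : ℝ in atTop, Chebyshev.psi x ≤ (1 + ε) * x := by
  have h := tendsto_psi_div.eventually (Iio_mem_nhds (show (1 : ℝ) < 1 + ε by linarith))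
  filter_upwards [h, eventually_gt_atTop 0] with x hx hx0
  rw [div_lt_iff₀ hx0] at hx
  exact hx.le

/-- For every `ε > 0`: `(1 - ε) x ≤ ψ(x)` for all large real `x`. [folklore] -/
theorem eventually_mul_le_psi {ε : ℝ} (hε : 0 < ε) :
    ∀ᶠ x : ℝ in atTop, (1 - ε) * x ≤ Chebyshev.psi x := by
  have h := tendsto_psi_div.eventually (Ioi_mem_nhds (show 1 - ε < (1 : ℝ) by linarith))
  filter_upwards [h, eventually_gt_atTop 0] with x hx hx0
  rw [lt_div_iff₀ hx0] at hx
  exact hx.le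

/-- **Growth of `D_{cn}`**: for a natural number `c` and every `ε > 0`,
`D_{c n} = lcm(1, …, c n) ≤ exp((c + ε) n)` for all large `n` (prime number theorem). This is the
estimate `(D_{35n}^3 D_{34n} D_{33n}^8)^{1/n} → e^{403}` of [Zudilin2004, §8, proof of Thm. 3] /
[Fischler2004, §3.3] in the one-factor form. [folklore] -/
theorem eventually_lcmUpto_mul_le_exp (c : ℕ) {ε : ℝ} (hε : 0 < ε) :
    ∀ᶠ n : ℕ in atTop, (Nat.lcmUpto (c * n) : ℝ) ≤ Real.exp ((c + ε) * n) := by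
  rcases Nat.eq_zero_or_pos c with rfl | hc
  · filter_upwards with n
    simp only [zero_mul, CharP.cast_eq_zero, zero_add]
    rw [show Nat.lcmUpto 0 = 1 by simp [Nat.lcmUpto]]
    simpa using Real.one_le_exp (by positivity)
  · -- `ψ(c n) ≤ (1 + ε/c) (c n) = (c + ε) n` for `n` large
    have hε' : 0 < ε / c := div_pos hε (by exact_mod_cast hc)
    have hψ := eventually_psi_le_mul hε'
    have hcn : Tendsto (fun n : ℕ => ((c * n : ℕ) : ℝ)) atTop atTop :=
      tendsto_natCast_atTop_atTop.comp (tendsto_id.const_mul_atTop' hc)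
    filter_upwards [hcn.eventually hψ] with n hn
    have hpos : (0 : ℝ) < Nat.lcmUpto (c * n) := by exact_mod_cast Nat.lcmUpto_pos _
    rw [← Real.log_le_iff_le_exp hpos, ← Chebyshev.psi_eq_log_lcmUpto]
    have hc0 : (c : ℝ) ≠ 0 := by exact_mod_cast hc.ne'
    have hid : (1 + ε / c) * ((c * n : ℕ) : ℝ) = (c + ε) * n := by
      push_cast
      field_simp
    linarith [hid]

/-- **Growth of powers and products of `D_{cn}`**, the form used for
`D_{35n}^3 D_{34n} D_{33n}^8 ≤ e^{(403+ε)n}`: for natural numbers `c, k` and `ε > 0`,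
`D_{cn}^k ≤ exp((c k + ε) n)` for all large `n`. [folklore] -/
theorem eventually_lcmUpto_mul_pow_le_exp (c k : ℕ) {ε : ℝ} (hε : 0 < ε) :
    ∀ᶠ n : ℕ in atTop, ((Nat.lcmUpto (c * n) : ℝ)) ^ k ≤ Real.exp ((c * k + ε) * n) := by
  rcases Nat.eq_zero_or_pos k with rfl | hk
  · filter_upwards with n
    simp only [pow_zero, CharP.cast_eq_zero, mul_zero, zero_add]
    exact Real.one_le_exp (by positivity)
  · have hε' : 0 < ε / k := div_pos hε (by exact_mod_cast hk)
    filter_upwards [eventually_lcmUpto_mul_le_exp c hε'] with n hn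
    have h0 : (0 : ℝ) ≤ Nat.lcmUpto (c * n) := by positivity
    calc ((Nat.lcmUpto (c * n) : ℝ)) ^ k ≤ (Real.exp ((c + ε / k) * n)) ^ k :=
          pow_le_pow_left₀ h0 hn k
      _ = Real.exp ((c * k + ε) * n) := by
          rw [← Real.exp_nat_mul]
          congr 1
          have hk0 : (k : ℝ) ≠ 0 := by exact_mod_cast hk.ne'
          field_simp

end Literature.NumberTheory.Transcendental
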